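import Summits.SmoothPoincare4.SmoothPoincare4.Theorems.CylinderEntropyCylinderRungTwoEquidistributionHeatFlow
import Summits.SmoothPoincare4.SmoothPoincare4.Theorems.CylinderEntropyCylinderRungTwoHeatSmoothingSmallTime
import Literature.Geometry.Riemannian.SphericalCylinderEntropy
import Mathlib.Analysis.Calculus.ContDiff.Polynomial
import Mathlib.Topology.ContinuousMap.Weierstrass
import HarnessLib

/-!
# Route `CylinderEntropy`, crux `CylinderRungTwo` (stmt-SmoothPoincare4-7631), line `killing-flux`:
# `S⁴`-equidistribution per height (registered helper `helper_equidistribution`, step S4 of the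
# area-quantization plan), part 2 — the limits `t → 0⁺`, `t → ∞` and the Weierstrass step

Let `μ` be a finite Borel measure on `ℝ⁶` carried by the slab `{z ∈ N | |z₅| ≤ B}` of the round
cylinder `N = S⁴ × ℝ = {∑_{i<5} zᵢ² = 1}`, and suppose that `μ` annihilates the height-weighted
Laplace–Beltrami operator of `S⁴`: for all `Φ ∈ C²(ℝ)` and `P ∈ C²(ℝ⁵)`,

  `∫ Φ(z₅) [Δ_{ℝ⁵} P(z') - D²P(z')(z', z') - 4 DP(z')(z')] dμ(z) = 0`,  `z' = truncL z`

(for `|z'| = 1` the bracket is `Δ_{S⁴}(P|_{S⁴})(z')`).  Then `μ` is uniform in the `S⁴` factor: for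
all continuous `Φ : ℝ → ℝ` and `g : ℝ⁵ → ℝ`,

  `∫ Φ(z₅) g(z') dμ = μH⁴(S⁴)⁻¹ · (∫_{S⁴} g dμH⁴) · ∫ Φ(z₅) dμ`.

Proof (the heat semigroup of `S⁴` built from the tree's typed zonal kernel `𝔥 = zonal`,
`T_t g(w) = ∫_{S⁴} 𝔥(t, ⟨w, y⟩) g(y) dμH⁴(y)`).  By part 1 (`…EquidistributionHeatFlow`,
`Equidistribution.flow_eq_flow`) the pairing `F(t) = ∫ Φ(z₅) T_t g(z') dμ` is constant on `(0, ∞)`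
for `Φ ∈ C²`.  As `t → ∞`, `T_t g → ∫_{S⁴} g` uniformly on `|w| ≤ 1` (landed
`helper_heatSmoothingLargeTime`), so `F(t) → (∫_{S⁴} g) ∫ Φ(z₅) dμ`; as `t → 0⁺`,
`T_t g → μH⁴(S⁴) g` uniformly on `S⁴` (landed `helper_heatSmoothingSmallTime`), so
`F(t) → μH⁴(S⁴) ∫ Φ(z₅) g(z') dμ` (both by the `sup × mass` estimate on the compact carrier of the
finite measure `μ`).  Hence `μH⁴(S⁴) ∫ Φ(z₅) g(z') dμ = (∫_{S⁴} g) ∫ Φ(z₅) dμ` for `Φ ∈ C²`, and for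
continuous `Φ` by Weierstrass approximation on `[-B, B]` (`exists_polynomial_near_of_continuousOn`;
polynomials are smooth, `Polynomial.contDiff_aeval`).  Finally divide by `μH⁴(S⁴) > 0`.

* `Equidistribution.mul_integral_eq_of_contDiff`, `Equidistribution.mul_integral_eq_of_continuous` —
  the identity for `Φ ∈ C²`, resp. continuous `Φ`, given the small-time limit for `g`;
* `equidistribution_of_smallTime` — the registered conclusion from the small-time statement;
* `helper_equidistribution` — the registered helper, verbatim.

Everything here is PROVED (no `sorry`, no new definitions, no named facts).

References: E. B. Davies, *Heat kernels and spectral theory* (1989), Ch. 5 (heat semigroup on a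
compact manifold: strong continuity at `0`, convergence to the mean); the argument is the standard
"a measure annihilating `Δ` of all smooth functions is invariant under the heat flow, hence uniform".
-/

-- the prescribed namespace `Summit.SmoothPoincare4.SmoothPoincare4.…` repeats `SmoothPoincare4`
set_option linter.dupNamespace false

noncomputable section

open MeasureTheory Set Filter
open scoped Manifold ContDiff ENNReal NNReal Topology BigOperators

namespace Summit.SmoothPoincare4.SmoothPoincare4.Cruxes.CylinderRungTwo.KillingFlux

open Literature.Geometry.Riemannian
open Literature.Geometry.Riemannian.SphericalCylinderEntropy (truncL zonal
  hausdorffMeasure_sphere_four_pos hausdorffMeasure_sphere_four_lt_top)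
open HeatSmoothingContDiff HeatSmoothingLargeTime

namespace Equidistribution

/-! ### Step A: the identity for `Φ ∈ C²` -/

/-- **Equidistribution for `Φ ∈ C²(ℝ)`**, given the small-time limit of the heat smoothing:
`μH⁴(S⁴) ∫ Φ(z₅) g(z') dμ = (∫_{S⁴} g) ∫ Φ(z₅) dμ` (constancy of `F`, `t → 0⁺` and `t → ∞`).
[folklore] -/
theorem mul_integral_eq_of_contDiff {B : ℝ} (μ : Measure (EuclideanSpace ℝ (Fin 6)))
    [IsFiniteMeasure μ]
    (hsupp : μ {z : EuclideanSpace ℝ (Fin 6) |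
      ¬ (∑ i : Fin 5, z (Fin.castSucc i) ^ 2 = 1 ∧ |z 5| ≤ B)} = 0)
    (hH : ∀ Φ : ℝ → ℝ, ContDiff ℝ 2 Φ → ∀ P : EuclideanSpace ℝ (Fin 5) → ℝ, ContDiff ℝ 2 P →
      ∫ z, Φ (z 5) *
        ((∑ j : Fin 5, iteratedFDeriv ℝ 2 P (truncL z)
            ![EuclideanSpace.single j (1 : ℝ), EuclideanSpace.single j (1 : ℝ)])
          - iteratedFDeriv ℝ 2 P (truncL z) ![truncL z, truncL z]
          - 4 * fderiv ℝ P (truncL z) (truncL z)) ∂μ = 0)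
    {g : EuclideanSpace ℝ (Fin 5) → ℝ} (hg : Continuous g)
    (hsmall : ∀ ε : ℝ, 0 < ε → ∃ t₀ : ℝ, 0 < t₀ ∧ ∀ t : ℝ, 0 < t → t ≤ t₀ →
      ∀ x : EuclideanSpace ℝ (Fin 5), ∑ i : Fin 5, x i ^ 2 = 1 →
        |(∫ y in Metric.sphere (0 : EuclideanSpace ℝ (Fin 5)) 1,
            zonal t (∑ i : Fin 5, x i * y i) * g y ∂μH[4]) -
          (μH[4] (Metric.sphere (0 : EuclideanSpace ℝ (Fin 5)) 1)).toReal * g x| ≤ ε)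
    {Φ : ℝ → ℝ} (hΦ : ContDiff ℝ 2 Φ) :
    (μH[4] (Metric.sphere (0 : EuclideanSpace ℝ (Fin 5)) 1)).toReal *
        ∫ z, Φ (z 5) * g (truncL z) ∂μ =
      (∫ y in Metric.sphere (0 : EuclideanSpace ℝ (Fin 5)) 1, g y ∂μH[4]) * ∫ z, Φ (z 5) ∂μ := by
  have hΦc : Continuous Φ := hΦ.continuous
  obtain ⟨A₀, hA₀⟩ := (isCompact_Icc (a := -B) (b := B)).exists_bound_of_continuousOn hΦc.continuousOn
  -- a nonnegative bound `A` for `|Φ|` on `[-B, B]`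
  have hA : ∀ s ∈ Icc (-B) B, |Φ s| ≤ max A₀ 0 := fun s hs =>
    (Real.norm_eq_abs _ ▸ hA₀ s hs).trans (le_max_left _ _)
  have hA0 : 0 ≤ max A₀ 0 := le_max_right _ _
  refine eq_of_abs_sub_le_mul (K := 2 * (max A₀ 0 * μ.real univ)) (by positivity) fun ε hε => ?_
  obtain ⟨t₁, ht₁, hsm⟩ := hsmall ε hε
  obtain ⟨t₂, ht₂, hla⟩ := helper_heatSmoothingLargeTime g hg ε hε
  have hQc : ∀ {x : ℝ}, 0 < x → Continuous fun w : EuclideanSpace ℝ (Fin 5) =>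
      ∫ y in Metric.sphere (0 : EuclideanSpace ℝ (Fin 5)) 1, zonal x (∑ i : Fin 5, w i * y i) * g y
        ∂μH[4] := fun hx => (contDiff_zonalSmoothing hx hg).continuous
  -- small time: `F(t₁)` is close to `μH⁴(S⁴) ∫ Φ g`
  have hE₁ := abs_integral_mul_sub_mul_le μ hsupp hΦc hA (hQc ht₁) (hg.const_mul _)
    (ε := ε) fun w hw => hsm t₁ ht₁ le_rfl w (sum_sq_eq_one_of_mem_sphere hw)
  -- large time: `F(t₂)` is close to `(∫ g) ∫ Φ`
  have hE₂ := abs_integral_mul_sub_mul_le μ hsupp hΦc hA (hQc ht₂) continuous_const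
    (v := fun _ => ∫ y in Metric.sphere (0 : EuclideanSpace ℝ (Fin 5)) 1, g y ∂μH[4])
    (ε := ε) fun w hw => hla t₂ le_rfl w (mem_sphere_zero_iff_norm.1 hw).le
  -- constancy
  have hF := flow_eq_flow μ hsupp hH hΦ hg ht₁ ht₂
  have hI₁ : (∫ z, Φ (z 5) * ((μH[4] (Metric.sphere (0 : EuclideanSpace ℝ (Fin 5)) 1)).toReal *
      g (truncL z)) ∂μ) =
      (μH[4] (Metric.sphere (0 : EuclideanSpace ℝ (Fin 5)) 1)).toReal *
        ∫ z, Φ (z 5) * g (truncL z) ∂μ := by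
    rw [← integral_const_mul]
    exact integral_congr_ae (Eventually.of_forall fun z => by ring)
  have hI₂ : (∫ z, Φ (z 5) * (∫ y in Metric.sphere (0 : EuclideanSpace ℝ (Fin 5)) 1, g y ∂μH[4]) ∂μ) =
      (∫ y in Metric.sphere (0 : EuclideanSpace ℝ (Fin 5)) 1, g y ∂μH[4]) * ∫ z, Φ (z 5) ∂μ := by
    rw [integral_mul_const, mul_comm]
  rw [hI₁, hF] at hE₁
  rw [hI₂] at hE₂
  calc _ ≤ max A₀ 0 * ε * μ.real univ + max A₀ 0 * ε * μ.real univ := by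
        refine (abs_sub_le _ (∫ z, Φ (z 5) * (∫ y in Metric.sphere (0 : EuclideanSpace ℝ (Fin 5)) 1,
          zonal t₂ (∑ i : Fin 5, truncL z i * y i) * g y ∂μH[4]) ∂μ) _).trans (add_le_add ?_ hE₂)
        rwa [abs_sub_comm]
    _ = 2 * (max A₀ 0 * μ.real univ) * ε := by ring

/-! ### Step B: continuous `Φ` by Weierstrass approximation -/

/-- **Equidistribution for continuous `Φ`**, given the small-time limit: approximate `Φ` uniformly on
`[-B, B]` by polynomials (`exists_polynomial_near_of_continuousOn`), which are `C²`
(`Polynomial.contDiff_aeval`), and pass to the limit in both sides (all integrands are bounded on the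
compact carrier of the finite measure `μ`). [folklore] -/
theorem mul_integral_eq_of_continuous {B : ℝ} (μ : Measure (EuclideanSpace ℝ (Fin 6)))
    [IsFiniteMeasure μ]
    (hsupp : μ {z : EuclideanSpace ℝ (Fin 6) |
      ¬ (∑ i : Fin 5, z (Fin.castSucc i) ^ 2 = 1 ∧ |z 5| ≤ B)} = 0)
    (hH : ∀ Φ : ℝ → ℝ, ContDiff ℝ 2 Φ → ∀ P : EuclideanSpace ℝ (Fin 5) → ℝ, ContDiff ℝ 2 P →
      ∫ z, Φ (z 5) *
        ((∑ j : Fin 5, iteratedFDeriv ℝ 2 P (truncL z)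
            ![EuclideanSpace.single j (1 : ℝ), EuclideanSpace.single j (1 : ℝ)])
          - iteratedFDeriv ℝ 2 P (truncL z) ![truncL z, truncL z]
          - 4 * fderiv ℝ P (truncL z) (truncL z)) ∂μ = 0)
    {g : EuclideanSpace ℝ (Fin 5) → ℝ} (hg : Continuous g)
    (hsmall : ∀ ε : ℝ, 0 < ε → ∃ t₀ : ℝ, 0 < t₀ ∧ ∀ t : ℝ, 0 < t → t ≤ t₀ →
      ∀ x : EuclideanSpace ℝ (Fin 5), ∑ i : Fin 5, x i ^ 2 = 1 →
        |(∫ y in Metric.sphere (0 : EuclideanSpace ℝ (Fin 5)) 1,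
            zonal t (∑ i : Fin 5, x i * y i) * g y ∂μH[4]) -
          (μH[4] (Metric.sphere (0 : EuclideanSpace ℝ (Fin 5)) 1)).toReal * g x| ≤ ε)
    {Φ : ℝ → ℝ} (hΦ : Continuous Φ) :
    (μH[4] (Metric.sphere (0 : EuclideanSpace ℝ (Fin 5)) 1)).toReal *
        ∫ z, Φ (z 5) * g (truncL z) ∂μ =
      (∫ y in Metric.sphere (0 : EuclideanSpace ℝ (Fin 5)) 1, g y ∂μH[4]) * ∫ z, Φ (z 5) ∂μ := by
  obtain ⟨G₀, hG₀⟩ :=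
    (isCompact_sphere (0 : EuclideanSpace ℝ (Fin 5)) 1).exists_bound_of_continuousOn hg.continuousOn
  have hG : ∀ w ∈ Metric.sphere (0 : EuclideanSpace ℝ (Fin 5)) 1, |g w| ≤ max G₀ 0 := fun w hw =>
    (Real.norm_eq_abs _ ▸ hG₀ w hw).trans (le_max_left _ _)
  have hV0 : 0 ≤ (μH[4] (Metric.sphere (0 : EuclideanSpace ℝ (Fin 5)) 1)).toReal :=
    ENNReal.toReal_nonneg
  refine eq_of_abs_sub_le_mul
    (K := ((μH[4] (Metric.sphere (0 : EuclideanSpace ℝ (Fin 5)) 1)).toReal * max G₀ 0 +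
      |∫ y in Metric.sphere (0 : EuclideanSpace ℝ (Fin 5)) 1, g y ∂μH[4]|) * μ.real univ)
    (by positivity) fun ε hε => ?_
  -- a polynomial `ε`-close to `Φ` on `[-B, B]`
  obtain ⟨p, hp⟩ := exists_polynomial_near_of_continuousOn (-B) B Φ hΦ.continuousOn ε hε
  have hpc : ContDiff ℝ 2 fun s : ℝ => Polynomial.aeval s p := p.contDiff_aeval 2
  have hpe : ∀ s : ℝ, (fun s : ℝ => Polynomial.aeval s p) s = p.eval s := fun s =>
    congrFun (Polynomial.coe_aeval_eq_eval s) p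
  have hpΦ : ∀ s ∈ Icc (-B) B, |(fun s : ℝ => Polynomial.aeval s p) s - Φ s| ≤ ε := fun s hs => by
    rw [hpe]
    exact (hp s hs).le
  -- Step A for the polynomial
  have hA := mul_integral_eq_of_contDiff μ hsupp hH hg hsmall hpc
  -- the two approximation errors
  have hE₁ := abs_integral_sub_integral_le μ hsupp hpc.continuous hΦ hpΦ hg hG
  have hE₂ := abs_integral_sub_integral_le μ hsupp hpc.continuous hΦ hpΦ continuous_const
    (u := fun _ => (1 : ℝ)) (U := 1) fun w _ => by simp
  simp only [mul_one] at hE₂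
  -- combine
  have key : (μH[4] (Metric.sphere (0 : EuclideanSpace ℝ (Fin 5)) 1)).toReal *
        (∫ z, Φ (z 5) * g (truncL z) ∂μ) -
      (∫ y in Metric.sphere (0 : EuclideanSpace ℝ (Fin 5)) 1, g y ∂μH[4]) * ∫ z, Φ (z 5) ∂μ =
      (∫ y in Metric.sphere (0 : EuclideanSpace ℝ (Fin 5)) 1, g y ∂μH[4]) *
          ((∫ z, (fun s : ℝ => Polynomial.aeval s p) (z 5) ∂μ) - ∫ z, Φ (z 5) ∂μ) -
        (μH[4] (Metric.sphere (0 : EuclideanSpace ℝ (Fin 5)) 1)).toReal *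
          ((∫ z, (fun s : ℝ => Polynomial.aeval s p) (z 5) * g (truncL z) ∂μ) -
            ∫ z, Φ (z 5) * g (truncL z) ∂μ) := by
    linear_combination hA
  rw [key]
  calc _ ≤ |(∫ y in Metric.sphere (0 : EuclideanSpace ℝ (Fin 5)) 1, g y ∂μH[4]) *
          ((∫ z, (fun s : ℝ => Polynomial.aeval s p) (z 5) ∂μ) - ∫ z, Φ (z 5) ∂μ)| +
        |(μH[4] (Metric.sphere (0 : EuclideanSpace ℝ (Fin 5)) 1)).toReal *
          ((∫ z, (fun s : ℝ => Polynomial.aeval s p) (z 5) * g (truncL z) ∂μ) -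
            ∫ z, Φ (z 5) * g (truncL z) ∂μ)| := abs_sub _ _
    _ ≤ |∫ y in Metric.sphere (0 : EuclideanSpace ℝ (Fin 5)) 1, g y ∂μH[4]| * (ε * μ.real univ) +
        (μH[4] (Metric.sphere (0 : EuclideanSpace ℝ (Fin 5)) 1)).toReal *
          (ε * max G₀ 0 * μ.real univ) := by
        rw [abs_mul, abs_mul, abs_of_nonneg hV0]
        exact add_le_add (mul_le_mul_of_nonneg_left hE₂ (abs_nonneg _))
          (mul_le_mul_of_nonneg_left hE₁ hV0)
    _ = _ := by ring

end Equidistribution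

open Equidistribution

/-- **Equidistribution from the small-time limit.** The registered conclusion of
`helper_equidistribution`, with the small-time behaviour of the heat smoothing
(`T_t g → μH⁴(S⁴) g` uniformly on `S⁴` as `t → 0⁺`, the registered sibling
`helper_heatSmoothingSmallTime`) as an explicit hypothesis. [folklore] -/
theorem equidistribution_of_smallTime
    (hsmall : ∀ g : EuclideanSpace ℝ (Fin 5) → ℝ, Continuous g → ∀ ε : ℝ, 0 < ε → ∃ t₀ : ℝ, 0 < t₀ ∧
      ∀ t : ℝ, 0 < t → t ≤ t₀ → ∀ x : EuclideanSpace ℝ (Fin 5), ∑ i : Fin 5, x i ^ 2 = 1 →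
        |(∫ y in Metric.sphere (0 : EuclideanSpace ℝ (Fin 5)) 1,
            Literature.Geometry.Riemannian.SphericalCylinderEntropy.zonal t (∑ i : Fin 5, x i * y i) *
              g y ∂(μH[4] : Measure (EuclideanSpace ℝ (Fin 5)))) -
          (μH[4] (Metric.sphere (0 : EuclideanSpace ℝ (Fin 5)) 1)).toReal * g x| ≤ ε) :
    ∀ (B : ℝ) (μ : Measure (EuclideanSpace ℝ (Fin 6))) [IsFiniteMeasure μ],
    μ {z : EuclideanSpace ℝ (Fin 6) | ¬ (∑ i : Fin 5, z (Fin.castSucc i) ^ 2 = 1 ∧ |z 5| ≤ B)} = 0 →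
    (∀ Φ : ℝ → ℝ, ContDiff ℝ 2 Φ → ∀ P : EuclideanSpace ℝ (Fin 5) → ℝ, ContDiff ℝ 2 P →
      ∫ z, Φ (z 5) *
        ((∑ j : Fin 5, iteratedFDeriv ℝ 2 P (truncL z)
            ![EuclideanSpace.single j (1 : ℝ), EuclideanSpace.single j (1 : ℝ)])
          - iteratedFDeriv ℝ 2 P (truncL z) ![truncL z, truncL z]
          - 4 * fderiv ℝ P (truncL z) (truncL z)) ∂μ = 0) →
    ∀ Φ : ℝ → ℝ, Continuous Φ → ∀ g : EuclideanSpace ℝ (Fin 5) → ℝ, Continuous g →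
      ∫ z, Φ (z 5) * g (truncL z) ∂μ =
        ((μH[4] (Metric.sphere (0 : EuclideanSpace ℝ (Fin 5)) 1)).toReal)⁻¹ *
          (∫ y in Metric.sphere (0 : EuclideanSpace ℝ (Fin 5)) 1, g y
            ∂(μH[4] : Measure (EuclideanSpace ℝ (Fin 5)))) *
          ∫ z, Φ (z 5) ∂μ := by
  intro B μ _ hsupp hH Φ hΦ g hg
  have hV : (μH[4] (Metric.sphere (0 : EuclideanSpace ℝ (Fin 5)) 1)).toReal ≠ 0 :=
    (ENNReal.toReal_pos hausdorffMeasure_sphere_four_pos.ne' hausdorffMeasure_sphere_four_lt_top.ne).ne'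
  have h := mul_integral_eq_of_continuous μ hsupp hH hg (hsmall g hg) hΦ
  rw [mul_assoc, ← h, ← mul_assoc, inv_mul_cancel₀ hV, one_mul]

/-- **Registered helper `helper_equidistribution` of line `killing-flux` (step S4 of the
area-quantization plan: `S⁴`-equidistribution per height).** A finite measure `μ` on `ℝ⁶` carried by
the slab `{z ∈ N | |z₅| ≤ B}` of `N = S⁴ × ℝ` which annihilates `Φ(z₅) Δ_{S⁴}(P|_{S⁴})(z')`
(written ambiently as `Φ(z₅) [∑_j D²P(z')(eⱼ,eⱼ) - D²P(z')(z',z') - 4 DP(z')(z')]`) for all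
`Φ ∈ C²(ℝ)`, `P ∈ C²(ℝ⁵)` is uniform in the `S⁴` factor:
`∫ Φ(z₅) g(z') dμ = μH⁴(S⁴)⁻¹ (∫_{S⁴} g dμH⁴) ∫ Φ(z₅) dμ` for all continuous `Φ`, `g`
(`equidistribution_of_smallTime` and the landed `helper_heatSmoothingSmallTime`). [folklore] -/
theorem helper_equidistribution : ∀ (B : ℝ) (μ : Measure (EuclideanSpace ℝ (Fin 6))) [IsFiniteMeasure μ], μ {z : EuclideanSpace ℝ (Fin 6) | ¬ (∑ i : Fin 5, z (Fin.castSucc i) ^ 2 = 1 ∧ |z 5| ≤ B)} = 0 → (∀ Φ : ℝ → ℝ, ContDiff ℝ 2 Φ → ∀ P : EuclideanSpace ℝ (Fin 5) → ℝ, ContDiff ℝ 2 P → ∫ z, Φ (z 5) * ((∑ j : Fin 5, iteratedFDeriv ℝ 2 P (truncL z) ![EuclideanSpace.single j (1 : ℝ), EuclideanSpace.single j (1 : ℝ)]) - iteratedFDeriv ℝ 2 P (truncL z) ![truncL z, truncL z] - 4 * fderiv ℝ P (truncL z) (truncL z)) ∂μ = 0) → ∀ Φ : ℝ → ℝ, Continuous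 Φ → ∀ g : EuclideanSpace ℝ (Fin 5) → ℝ, Continuous g → ∫ z, Φ (z 5) * g (truncL z) ∂μ = ((μH[4] (Metric.sphere (0 : EuclideanSpace ℝ (Fin 5)) 1)).toReal)⁻¹ * (∫ y in Metric.sphere (0 : EuclideanSpace ℝ (Fin 5)) 1, g y ∂(μH[4] : Measure (EuclideanSpace ℝ (Fin 5)))) * ∫ z, Φ (z 5) ∂μ :=
  equidistribution_of_smallTime helper_heatSmoothingSmallTime

end Summit.SmoothPoincare4.SmoothPoincare4.Cruxes.CylinderRungTwo.KillingFlux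

end
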